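import Literature.Barriers.RiemannHypothesis.DavenportHeilbronnHamburgerTools
import Literature.Barriers.RiemannHypothesis.DavenportHeilbronnHamburgerDecay
import Mathlib.Analysis.Calculus.Deriv.Polynomial
import HarnessLib

/-!
# Tools for Hamburger's theorem, III: the modular relation of the theta series

Support file for the discharge of `Literature.Barriers.RiemannHypothesis.Hamburger`
(Titchmarsh, *The Theory of the Riemann Zeta-Function*, §2.13). Everything here is PROVED.

With `w = s/2`, `M(w) = G(2w)Γ(w)π^{-w}/P(2w)` and `F_x(w) = M(w) x^{-w}`, the two theta series
`θ_a(x) = ∑_{n ≥ 1} a(n) e^{-πn²x}`, `θ_b` satisfy, for `x > 0`,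

  `θ_a(x) − x^{-1/2} θ_b(1/x) = (2πi)⁻¹ ∮_{∂([c',c]×[-T,T])} F_x(w) dw`

(`theta_sub_eq_rectBoundaryIntegral`): Titchmarsh's `∑ aₙe^{-πn²x} = x^{-1/2}∑ bₙe^{-πn²/x} + ½Q(x)`
with the residue sum `Q` kept as a boundary integral around the box containing all the poles.
-/

noncomputable section

open _root_.Complex Set MeasureTheory Filter intervalIntegral Real
open scoped _root_.Topology

namespace Literature.Barriers.RiemannHypothesis

namespace Hamburger1921

open Literature.Analysis.Complex Literature.Analysis.SpecialFunctions

/-! ### Choice of the two abscissae and of the box -/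

/-- **Abscissae and box.** For a non-zero polynomial `P` and `α > 0` there are `c ∈ (1/2, 1)`,
`c' ≤ -1/2` with `2c' < -α`, `c' ∉ -ℕ`, and `T > 0` such that every zero `2w` of `P` has
`|im w| < T` and `re w ∉ {c, c'}` (finitely many zeros). [folklore] -/
theorem exists_abscissae (P : Polynomial ℂ) (hP : P ≠ 0) {α : ℝ} (hα : 0 < α) :
    ∃ c c' T : ℝ, 1 / 2 < c ∧ c < 1 ∧ 2 * c' < -α ∧ c' ≤ -1 / 2 ∧ (∀ n : ℕ, c' ≠ -n) ∧ 0 < T ∧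
      (∀ w : ℂ, P.eval (2 * w) = 0 → |w.im| < T ∧ w.re ≠ c ∧ w.re ≠ c') := by
  classical
  set S : Finset ℂ := P.roots.toFinset with hS
  have hmem : ∀ w : ℂ, P.eval (2 * w) = 0 → 2 * w ∈ S := fun w hw ↦ by
    rw [hS, Multiset.mem_toFinset, Polynomial.mem_roots hP]; exact hw
  -- the height of the box
  set T : ℝ := 1 + ∑ ρ ∈ S, |ρ.im| with hT
  have hsum0 : 0 ≤ ∑ ρ ∈ S, |ρ.im| := Finset.sum_nonneg fun ρ _ ↦ abs_nonneg ρ.im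
  have hT0 : 0 < T := by rw [hT]; linarith
  have hTim : ∀ w : ℂ, P.eval (2 * w) = 0 → |w.im| < T := by
    intro w hw
    have h1 : |(2 * w).im| ≤ ∑ ρ ∈ S, |ρ.im| :=
      Finset.single_le_sum (f := fun ρ : ℂ ↦ |ρ.im|) (fun ρ _ ↦ abs_nonneg _) (hmem w hw)
    have h2 : |(2 * w).im| = 2 * |w.im| := by simp [abs_mul]
    rw [hT]; linarith [abs_nonneg w.im]
  -- the right abscissa
  set R : Finset ℝ := S.image fun ρ : ℂ ↦ ρ.re / 2 with hR
  have hRmem : ∀ w : ℂ, P.eval (2 * w) = 0 → w.re ∈ R := fun w hw ↦ by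
    rw [hR, Finset.mem_image]; exact ⟨2 * w, hmem w hw, by simp⟩
  obtain ⟨c, hcI, hcR⟩ := (Set.Ioo_infinite (by norm_num : (1 / 2 : ℝ) < 1)).exists_notMem_finset R
  -- the left abscissa
  set L : ℝ := -α / 2 - 1 / 2 with hL
  set N : ℕ := ⌈1 - L⌉₊ + 1 with hN
  set R' : Finset ℝ := R ∪ (Finset.range N).image fun n : ℕ ↦ -(n : ℝ) with hR'
  obtain ⟨c', hc'I, hc'R⟩ :=
    (Set.Ioo_infinite (by linarith : L - 1 < L)).exists_notMem_finset R'
  have hc'1 : 2 * c' < -α := by rw [hL] at hc'I; linarith [hc'I.2]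
  have hc'2 : c' ≤ -1 / 2 := by rw [hL] at hc'I; linarith [hc'I.2]
  refine ⟨c, c', T, hcI.1, hcI.2, hc'1, hc'2, fun n hn ↦ ?_, hT0, fun w hw ↦
    ⟨hTim w hw, fun h ↦ hcR (h ▸ hRmem w hw), fun h ↦ hc'R ?_⟩⟩
  · rcases lt_or_ge n N with h | h
    · refine hc'R ?_
      rw [hR', Finset.mem_union]
      exact Or.inr (Finset.mem_image.2 ⟨n, Finset.mem_range.2 h, hn.symm⟩)
    · have h1 : (N : ℝ) ≤ n := by exact_mod_cast h
      have h2 : 1 - L ≤ ⌈1 - L⌉₊ := Nat.le_ceil _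
      have h3 : (N : ℝ) = ⌈1 - L⌉₊ + 1 := by rw [hN]; push_cast; ring
      linarith [hc'I.1]
  · rw [hR', Finset.mem_union]
    exact Or.inl (h ▸ hRmem w hw)

/-! ### The integrand `L(f, 2w) q^{-w} Γ(w)` on a vertical line -/

/-- `y ↦ L(f, 2(σ + iy))` is continuous when `∑ |f(n)| n^{-2σ} < ∞` (uniform convergence).
[folklore] -/
theorem continuous_LSeries_two_mul_vertical {f : ℕ → ℂ} {σ : ℝ}
    (hsum : LSeriesSummable f (2 * (σ : ℂ))) :
    Continuous fun y : ℝ ↦ LSeries f (2 * ((σ : ℂ) + y * I)) := by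
  have hcontn : ∀ n : ℕ, Continuous fun y : ℝ ↦ LSeries.term f (2 * ((σ : ℂ) + y * I)) n := by
    intro n
    rcases eq_or_ne n 0 with rfl | hn
    · simp only [LSeries.term_zero]; exact continuous_const
    · simp only [LSeries.term_of_ne_zero hn, div_eq_mul_inv]
      have hnC : (n : ℂ) ≠ 0 := by exact_mod_cast hn
      refine continuous_const.mul (Continuous.inv₀ ?_ fun y h0 ↦ ?_)
      · exact Continuous.const_cpow (by fun_prop) (Or.inl hnC)
      · exact hnC ((Complex.cpow_eq_zero_iff _ _).1 h0).1
  have hbound : ∀ (n : ℕ) (y : ℝ), ‖LSeries.term f (2 * ((σ : ℂ) + y * I)) n‖ ≤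
      ‖LSeries.term f (2 * (σ : ℂ)) n‖ := by
    intro n y
    simp [LSeries.norm_term_eq]
  simp only [LSeries]
  exact continuous_tsum hcontn (summable_norm_iff.2 hsum) hbound

/-- For `σ > 0`, `q > 0` and `∑ |f(n)| n^{-2σ} < ∞`, the function
`y ↦ L(f, 2(σ+iy)) · q^{-(σ+iy)} Γ(σ+iy)` is integrable on `ℝ` (`Γ` is, the rest is bounded and
continuous). [folklore] -/
theorem integrable_LSeries_mul_cpow_mul_Gamma {f : ℕ → ℂ} {σ : ℝ} (hσ : 0 < σ)
    (hsum : LSeriesSummable f (2 * (σ : ℂ))) {q : ℝ} (hq : 0 < q) :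
    Integrable fun y : ℝ ↦ LSeries f (2 * ((σ : ℂ) + y * I)) *
      (((q : ℝ) : ℂ) ^ (-((σ : ℂ) + y * I)) * Complex.Gamma ((σ : ℂ) + y * I)) := by
  have hΓ := integrable_Gamma_vertical_of_pos hσ
  have hcontw : Continuous fun y : ℝ ↦ ((q : ℝ) : ℂ) ^ (-((σ : ℂ) + y * I)) :=
    Continuous.const_cpow (by fun_prop) (Or.inl (by exact_mod_cast hq.ne'))
  have hre : ∀ y : ℝ, (-((σ : ℂ) + y * I)).re = -σ := by intro y; simp
  have hsum' : LSeriesSummable f ((2 * σ : ℝ) : ℂ) := by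
    convert hsum using 2; push_cast; ring
  have h := hΓ.bdd_mul (((continuous_LSeries_two_mul_vertical hsum).mul hcontw).aestronglyMeasurable)
    (c := (∑' n, ‖LSeries.term f ((2 * σ : ℝ) : ℂ) n‖) * q ^ (-σ))
    (Eventually.of_forall fun y ↦ ?_)
  · refine h.congr (Eventually.of_forall fun y ↦ ?_)
    simp only [Pi.mul_apply]; ring
  · simp only [Pi.mul_apply]
    rw [norm_mul, Complex.norm_cpow_eq_rpow_re_of_pos hq, hre]
    have h2re : (2 * ((σ : ℂ) + y * I)).re = (2 * σ : ℝ) := by simp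
    exact mul_le_mul_of_nonneg_right (norm_LSeries_le_tsum h2re hsum') (by positivity)

/-! ### The right line: `θ_a` -/

/-- On `re w = c > 1/2` off the zeros of `P(2w)`, `F_x(c+iy) = L(a, 2w)·(πx)^{-w}Γ(w)`
(`F_x(w) = G(2w)Γ(w)π^{-w}x^{-w}/P(2w)`, `w = c + iy`; since `P(2w)L(a,2w) = G(2w)`). [folklore] -/
theorem right_line_pointwise {a : ℕ → ℂ} {G : ℂ → ℂ} {P : Polynomial ℂ}
    (ha : ∀ s : ℂ, 1 < s.re → LSeriesSummable a s ∧ P.eval s * LSeries a s = G s)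
    {c : ℝ} (hc : 1 / 2 < c) (hPc : ∀ y : ℝ, P.eval (2 * ((c : ℂ) + y * I)) ≠ 0) {x : ℝ}
    (hx : 0 < x) (y : ℝ) :
    G (2 * ((c : ℂ) + y * I)) / P.eval (2 * ((c : ℂ) + y * I)) *
        Complex.Gamma ((c : ℂ) + y * I) * (π : ℂ) ^ (-((c : ℂ) + y * I)) *
          (x : ℂ) ^ (-((c : ℂ) + y * I)) =
      LSeries a (2 * ((c : ℂ) + y * I)) *
        (((π * x : ℝ) : ℂ) ^ (-((c : ℂ) + y * I)) * Complex.Gamma ((c : ℂ) + y * I)) := by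
  set w : ℂ := (c : ℂ) + y * I with hw
  have hw2 : 1 < (2 * w).re := by simp [hw]; linarith
  obtain ⟨-, hG⟩ := ha (2 * w) hw2
  have hPw : P.eval (2 * w) ≠ 0 := hPc y
  have hGP : G (2 * w) / P.eval (2 * w) = LSeries a (2 * w) := by
    rw [← hG]; field_simp
  rw [hGP, Complex.ofReal_mul, Complex.mul_cpow_ofReal_nonneg Real.pi_pos.le hx.le]
  ring

/-- On `re w = c > 1/2` off the zeros of `P(2w)`:
`(1/2π) ∫ F_x(c + iy) dy = ∑_{n ≥ 1} a(n) e^{−πn²x}` (Titchmarsh §2.13, first display: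
`φ(x) = (1/2πi)∫_{(2)} f(s)Γ(½s)π^{-s/2}x^{-s/2} ds = 2∑ aₙ e^{-πn²x}`, here with `w = s/2` on
any admissible line). [cite: Titchmarsh1986, §2.13] -/
theorem integral_right_line_eq_tsum {a : ℕ → ℂ} {G : ℂ → ℂ} {P : Polynomial ℂ}
    (ha : ∀ s : ℂ, 1 < s.re → LSeriesSummable a s ∧ P.eval s * LSeries a s = G s)
    {c : ℝ} (hc : 1 / 2 < c) (hPc : ∀ y : ℝ, P.eval (2 * ((c : ℂ) + y * I)) ≠ 0) {x : ℝ}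
    (hx : 0 < x) :
    (1 / (2 * π) : ℂ) * ∫ y : ℝ, G (2 * ((c : ℂ) + y * I)) / P.eval (2 * ((c : ℂ) + y * I)) *
        Complex.Gamma ((c : ℂ) + y * I) * (π : ℂ) ^ (-((c : ℂ) + y * I)) *
          (x : ℂ) ^ (-((c : ℂ) + y * I)) =
      ∑' n : ℕ, (if n = 0 then 0 else a n * (Real.exp (-(π * n ^ 2 * x)) : ℂ)) := by
  have hsum : LSeriesSummable a (2 * c) := (ha (2 * c) (by simp; linarith)).1
  rw [tsum_mul_exp_neg_pi_sq_eq_integral a (by linarith) hsum hx]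
  congr 1
  exact integral_congr_ae (Eventually.of_forall fun y ↦ right_line_pointwise ha hc hPc hx y)

/-! ### The left line: `x^{-1/2} θ_b(1/x)` -/

/-- On `re w = c'` (`2c' < -α`, `c' ∉ -ℕ`, off the zeros of `P(2w)`), the functional equation
gives `F_x(c'+iy) = x^{-1/2} · g(−y)` with
`g(y) = L(b, 2(σ+iy)) (π/x)^{-(σ+iy)} Γ(σ+iy)`, `σ = ½ − c'`. [folklore] -/
theorem left_line_pointwise {b : ℕ → ℂ} {G : ℂ → ℂ} {P : Polynomial ℂ} {α : ℝ}
    (hfe : ∀ s : ℂ, s.re < -α → P.eval s ≠ 0 → (∀ n : ℕ, s ≠ -(2 * (n : ℂ))) →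
      G s / P.eval s * Complex.Gamma (s / 2) * (π : ℂ) ^ (-s / 2) =
        LSeries b (1 - s) * Complex.Gamma (1 / 2 - s / 2) * (π : ℂ) ^ (-(1 - s) / 2))
    {c' : ℝ} (hc'α : 2 * c' < -α) (hc'N : ∀ n : ℕ, c' ≠ -n)
    (hPc' : ∀ y : ℝ, P.eval (2 * ((c' : ℂ) + y * I)) ≠ 0) {x : ℝ} (hx : 0 < x) (y : ℝ) :
    G (2 * ((c' : ℂ) + y * I)) / P.eval (2 * ((c' : ℂ) + y * I)) *
        Complex.Gamma ((c' : ℂ) + y * I) * (π : ℂ) ^ (-((c' : ℂ) + y * I)) *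
          (x : ℂ) ^ (-((c' : ℂ) + y * I)) =
      (x : ℂ) ^ (-(1 / 2 : ℂ)) * (LSeries b (2 * (((1 / 2 - c' : ℝ) : ℂ) + ((-y : ℝ) : ℂ) * I)) *
        ((((π * x⁻¹ : ℝ)) : ℂ) ^ (-(((1 / 2 - c' : ℝ) : ℂ) + ((-y : ℝ) : ℂ) * I)) *
          Complex.Gamma (((1 / 2 - c' : ℝ) : ℂ) + ((-y : ℝ) : ℂ) * I))) := by
  have hx0 : (x : ℂ) ≠ 0 := by exact_mod_cast hx.ne'
  have hxarg : (x : ℂ).arg ≠ π := by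
    rw [Complex.arg_ofReal_of_nonneg hx.le]; exact Real.pi_ne_zero.symm
  have hxhalf : (x : ℂ) ^ (-(1 / 2 : ℂ)) * (x : ℂ) ^ (1 / 2 : ℂ) = 1 := by
    rw [Complex.cpow_neg, inv_mul_cancel₀]
    exact fun h ↦ hx0 (Complex.cpow_eq_zero_iff _ _ |>.1 h).1
  set w : ℂ := (c' : ℂ) + y * I with hw
  have hw2 : (2 * w).re < -α := by simp [hw]; linarith
  have hs2n : ∀ n : ℕ, 2 * w ≠ -(2 * (n : ℂ)) := by
    intro n h
    have him := congrArg Complex.im h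
    have hre := congrArg Complex.re h
    simp [hw] at him hre
    exact hc'N n (by linarith)
  have hFE := hfe (2 * w) hw2 (hPc' y) hs2n
  rw [show 2 * w / 2 = w by ring, show -(2 * w) / 2 = -w by ring] at hFE
  have e1 : ((1 / 2 - c' : ℝ) : ℂ) + ((-y : ℝ) : ℂ) * I = 1 / 2 - w := by
    rw [hw]; push_cast; ring
  rw [e1, hFE, show 2 * (1 / 2 - w) = 1 - 2 * w by ring, Complex.ofReal_mul,
    Complex.mul_cpow_ofReal_nonneg Real.pi_pos.le (inv_pos.2 hx).le, Complex.ofReal_inv,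
    Complex.inv_cpow _ _ hxarg, ← Complex.cpow_neg, neg_neg,
    show (1 / 2 : ℂ) - w = 1 / 2 + -w by ring, Complex.cpow_add _ _ hx0,
    show -((1 : ℂ) / 2 + -w) = -(1 - 2 * w) / 2 by ring]
  calc LSeries b (1 - 2 * w) * Complex.Gamma (1 / 2 + -w) * (π : ℂ) ^ (-(1 - 2 * w) / 2) *
        (x : ℂ) ^ (-w)
      = ((x : ℂ) ^ (-(1 / 2 : ℂ)) * (x : ℂ) ^ (1 / 2 : ℂ)) * (LSeries b (1 - 2 * w) *
          Complex.Gamma (1 / 2 + -w) * (π : ℂ) ^ (-(1 - 2 * w) / 2) * (x : ℂ) ^ (-w)) := by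
        rw [hxhalf, one_mul]
    _ = _ := by ring

/-- On `re w = c'` (`2c' < -α`, `c' ≤ -1/2`, `c' ∉ -ℕ`, off the zeros of `P(2w)`):
`(1/2π) ∫ F_x(c' + iy) dy = x^{−1/2} ∑_{n ≥ 1} b(n) e^{−πn²/x}` (Titchmarsh §2.13:
`(1/2πi)∫_{(-1-α)} g(1−s)Γ(½−½s)π^{-(1−s)/2}x^{-s/2} ds = (2/√x)∑ bₙe^{−πn²/x}`).
[cite: Titchmarsh1986, §2.13] -/
theorem integral_left_line_eq_tsum {b : ℕ → ℂ} {G : ℂ → ℂ} {P : Polynomial ℂ} {α : ℝ}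
    (hb : ∀ s : ℂ, s.re < -α → LSeriesSummable b (1 - s))
    (hfe : ∀ s : ℂ, s.re < -α → P.eval s ≠ 0 → (∀ n : ℕ, s ≠ -(2 * (n : ℂ))) →
      G s / P.eval s * Complex.Gamma (s / 2) * (π : ℂ) ^ (-s / 2) =
        LSeries b (1 - s) * Complex.Gamma (1 / 2 - s / 2) * (π : ℂ) ^ (-(1 - s) / 2))
    {c' : ℝ} (hc'α : 2 * c' < -α) (hc'h : c' ≤ -1 / 2) (hc'N : ∀ n : ℕ, c' ≠ -n)
    (hPc' : ∀ y : ℝ, P.eval (2 * ((c' : ℂ) + y * I)) ≠ 0) {x : ℝ} (hx : 0 < x) :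
    (1 / (2 * π) : ℂ) * ∫ y : ℝ, G (2 * ((c' : ℂ) + y * I)) / P.eval (2 * ((c' : ℂ) + y * I)) *
        Complex.Gamma ((c' : ℂ) + y * I) * (π : ℂ) ^ (-((c' : ℂ) + y * I)) *
          (x : ℂ) ^ (-((c' : ℂ) + y * I)) =
      (x : ℂ) ^ (-(1 / 2 : ℂ)) *
        ∑' n : ℕ, (if n = 0 then 0 else b n * (Real.exp (-(π * n ^ 2 * x⁻¹)) : ℂ)) := by
  have hσ0 : 0 < 1 / 2 - c' := by linarith
  have hsum : LSeriesSummable b (2 * ((1 / 2 - c' : ℝ) : ℂ)) := by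
    have h := hb (2 * c') (by simp; linarith)
    convert h using 2; push_cast; ring
  have hθ := tsum_mul_exp_neg_pi_sq_eq_integral b hσ0 hsum (inv_pos.2 hx)
  set g : ℝ → ℂ := fun y ↦ LSeries b (2 * (((1 / 2 - c' : ℝ) : ℂ) + y * I)) *
    ((((π * x⁻¹ : ℝ)) : ℂ) ^ (-(((1 / 2 - c' : ℝ) : ℂ) + y * I)) *
      Complex.Gamma (((1 / 2 - c' : ℝ) : ℂ) + y * I)) with hg
  calc (1 / (2 * π) : ℂ) * ∫ y : ℝ, G (2 * ((c' : ℂ) + y * I)) / P.eval (2 * ((c' : ℂ) + y * I)) *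
        Complex.Gamma ((c' : ℂ) + y * I) * (π : ℂ) ^ (-((c' : ℂ) + y * I)) *
          (x : ℂ) ^ (-((c' : ℂ) + y * I))
      = (1 / (2 * π) : ℂ) * ∫ y : ℝ, (x : ℂ) ^ (-(1 / 2 : ℂ)) * g (-y) := by
        congr 1
        exact integral_congr_ae (Eventually.of_forall fun y ↦
          left_line_pointwise hfe hc'α hc'N hPc' hx y)
    _ = (x : ℂ) ^ (-(1 / 2 : ℂ)) * ((1 / (2 * π) : ℂ) * ∫ y : ℝ, g y) := by
        rw [MeasureTheory.integral_const_mul, integral_neg_eq_self g volume]; ring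
    _ = _ := by rw [hθ]

/-! ### Regular points of `M(w) = G(2w)Γ(w)π^{-w}/P(2w)` -/

/-- `M(w) = G(2w)Γ(w)π^{-w}/P(2w)` is complex differentiable at every `w` with `P(2w) ≠ 0`,
`w ∉ -ℕ`. [folklore] -/
theorem differentiableAt_M {G : ℂ → ℂ} (hG : Differentiable ℂ G) (P : Polynomial ℂ) {w : ℂ}
    (hPw : P.eval (2 * w) ≠ 0) (hΓw : ∀ m : ℕ, w ≠ -m) :
    DifferentiableAt ℂ (fun w : ℂ ↦ G (2 * w) / P.eval (2 * w) * Complex.Gamma w *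
      (π : ℂ) ^ (-w)) w := by
  refine DifferentiableAt.mul (DifferentiableAt.mul (DifferentiableAt.div ?_ ?_ hPw)
    (Complex.differentiableAt_Gamma w hΓw)) ?_
  · exact (hG.comp (differentiable_id.const_mul _)).differentiableAt
  · exact ((Polynomial.differentiable P).comp (differentiable_id.const_mul _)).differentiableAt
  · exact differentiableAt_id.neg.const_cpow (Or.inl (by exact_mod_cast Real.pi_ne_zero))

/-- Points of the closed strip `c' ≤ re w ≤ c` outside the open box `(c',c) × (-T,T)` (in
particular the boundary of the box and the two lines beyond it) are regular points:
`P(2w) ≠ 0` and `w ∉ -ℕ`, when the box encloses all the zeros of `P(2w)`, `c > 0` and `c' ∉ -ℕ`.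
[folklore] -/
theorem regular_of_not_mem_box {P : Polynomial ℂ} {c c' T : ℝ} (hc : 0 < c)
    (hc'N : ∀ n : ℕ, c' ≠ -n) (hT : 0 < T)
    (hroots : ∀ w : ℂ, P.eval (2 * w) = 0 → |w.im| < T ∧ w.re ≠ c ∧ w.re ≠ c')
    {w : ℂ} (hre : c' ≤ w.re ∧ w.re ≤ c) (hbox : ¬ (w.re ∈ Ioo c' c ∧ w.im ∈ Ioo (-T) T)) :
    P.eval (2 * w) ≠ 0 ∧ ∀ m : ℕ, w ≠ -m := by
  constructor
  · intro h0
    obtain ⟨h1, h2, h3⟩ := hroots w h0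
    exact hbox ⟨⟨lt_of_le_of_ne hre.1 (Ne.symm h3), lt_of_le_of_ne hre.2 h2⟩, abs_lt.1 h1⟩
  · intro m hm
    have h1 : w.re = -m := by rw [hm]; simp
    have h2 : w.im = 0 := by rw [hm]; simp
    have hm0 : (0 : ℝ) ≤ m := Nat.cast_nonneg m
    refine hbox ⟨⟨lt_of_le_of_ne hre.1 ?_, by linarith⟩, by rw [h2]; exact ⟨by linarith, hT⟩⟩
    intro h; exact hc'N m (by rw [h, h1])

/-! ### The modular relation -/

/-- For `x > 0`, `e^{-t} ≤ 1/t` for `t > 0`. [folklore] -/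
theorem exp_neg_le_inv {t : ℝ} (ht : 0 < t) : Real.exp (-t) ≤ t⁻¹ := by
  rw [Real.exp_neg]
  exact inv_anti₀ ht ((by linarith : t ≤ t + 1).trans (Real.add_one_le_exp t))

/-- **The modular relation** (Titchmarsh §2.13: "`∑ aₙ e^{−πn²x} = x^{-1/2}∑ bₙe^{−πn²/x} + ½Q(x)`",
`Q` = the sum of the residues of `f(s)Γ(½s)π^{-s/2}x^{-s/2}` between the two lines). Here, under
the hypotheses of Hamburger's theorem and with admissible abscissae `c, c'` and a box height `T`
enclosing all the singularities of `F_x(w) = G(2w)Γ(w)π^{-w}x^{-w}/P(2w)` in the strip: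
`∑_{n≥1} aₙe^{−πn²x} − x^{−1/2}∑_{n≥1} bₙe^{−πn²/x} = (2πi)⁻¹ ∮_{∂([c',c]×[−T,T])} F_x(w) dw`
(Cauchy's theorem with Phragmén–Lindelöf decay; the residues are not evaluated).
[cite: Titchmarsh1986, §2.13] -/
theorem theta_sub_eq_rectBoundaryIntegral
    {a b : ℕ → ℂ} {G : ℂ → ℂ} {P : Polynomial ℂ} {α : ℝ}
    (hG : Differentiable ℂ G)
    (hfin : ∃ A B : ℝ, ∀ s : ℂ, ‖G s‖ ≤ A * Real.exp (‖s‖ ^ B))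
    (hP : P ≠ 0)
    (ha : ∀ s : ℂ, 1 < s.re → LSeriesSummable a s ∧ P.eval s * LSeries a s = G s)
    (hb : ∀ s : ℂ, s.re < -α → LSeriesSummable b (1 - s))
    (hfe : ∀ s : ℂ, s.re < -α → P.eval s ≠ 0 → (∀ n : ℕ, s ≠ -(2 * (n : ℂ))) →
      G s / P.eval s * Complex.Gamma (s / 2) * (π : ℂ) ^ (-s / 2) =
        LSeries b (1 - s) * Complex.Gamma (1 / 2 - s / 2) * (π : ℂ) ^ (-(1 - s) / 2))
    {c c' T : ℝ} (hc : 1 / 2 < c) (hc1 : c < 1) (hc'α : 2 * c' < -α) (hc'h : c' ≤ -1 / 2)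
    (hc'N : ∀ n : ℕ, c' ≠ -n) (hT : 0 < T)
    (hroots : ∀ w : ℂ, P.eval (2 * w) = 0 → |w.im| < T ∧ w.re ≠ c ∧ w.re ≠ c')
    {x : ℝ} (hx : 0 < x) :
    ∑' n : ℕ, (if n = 0 then 0 else a n * (Real.exp (-(π * n ^ 2 * x)) : ℂ)) -
        (x : ℂ) ^ (-(1 / 2 : ℂ)) *
          ∑' n : ℕ, (if n = 0 then 0 else b n * (Real.exp (-(π * n ^ 2 * x⁻¹)) : ℂ)) =
      1 / (2 * π * I) * rectBoundaryIntegral (fun w : ℂ ↦ G (2 * w) / P.eval (2 * w) *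
        Complex.Gamma w * (π : ℂ) ^ (-w) * (x : ℂ) ^ (-w)) c' c (-T) T := by
  have hcc' : c' < c := by linarith
  have hPc : ∀ y : ℝ, P.eval (2 * ((c : ℂ) + y * I)) ≠ 0 := fun y h ↦ (hroots _ h).2.1 (by simp)
  have hPc' : ∀ y : ℝ, P.eval (2 * ((c' : ℂ) + y * I)) ≠ 0 :=
    fun y h ↦ (hroots _ h).2.2 (by simp)
  have hx0 : (x : ℂ) ≠ 0 := by exact_mod_cast hx.ne'
  -- differentiability off the box
  have hdiff : DifferentiableOn ℂ (fun w : ℂ ↦ G (2 * w) / P.eval (2 * w) * Complex.Gamma w *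
      (π : ℂ) ^ (-w) * (x : ℂ) ^ (-w)) ((re ⁻¹' Icc c' c) \ (Ioo c' c ×ℂ Ioo (-T) T)) := by
    intro w hw
    obtain ⟨hPw, hΓw⟩ := regular_of_not_mem_box (by linarith) hc'N hT hroots hw.1
      (fun h ↦ hw.2 (mem_reProdIm.2 h))
    exact ((differentiableAt_M hG P hPw hΓw).mul
      (differentiableAt_id.neg.const_cpow (Or.inl hx0))).differentiableWithinAt
  -- integrability on the two lines
  have hintc : Integrable fun y : ℝ ↦ (fun w : ℂ ↦ G (2 * w) / P.eval (2 * w) *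
      Complex.Gamma w * (π : ℂ) ^ (-w) * (x : ℂ) ^ (-w)) ((c : ℂ) + y * I) := by
    have hsum : LSeriesSummable a (2 * (c : ℂ)) := (ha (2 * c) (by simp; linarith)).1
    refine (integrable_LSeries_mul_cpow_mul_Gamma (by linarith) hsum (mul_pos Real.pi_pos hx)).congr
      (Eventually.of_forall fun y ↦ (right_line_pointwise ha hc hPc hx y).symm)
  have hintc' : Integrable fun y : ℝ ↦ (fun w : ℂ ↦ G (2 * w) / P.eval (2 * w) *
      Complex.Gamma w * (π : ℂ) ^ (-w) * (x : ℂ) ^ (-w)) ((c' : ℂ) + y * I) := by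
    have hσ0 : 0 < 1 / 2 - c' := by linarith
    have hsum : LSeriesSummable b (2 * ((1 / 2 - c' : ℝ) : ℂ)) := by
      have h := hb (2 * c') (by simp; linarith)
      convert h using 2; push_cast; ring
    have hg := integrable_LSeries_mul_cpow_mul_Gamma hσ0 hsum (mul_pos Real.pi_pos (inv_pos.2 hx))
    refine ((hg.comp_neg).const_mul ((x : ℂ) ^ (-(1 / 2 : ℂ)))).congr
      (Eventually.of_forall fun y ↦ ?_)
    simp only
    rw [left_line_pointwise hfe hc'α hc'N hPc' hx y]
  -- uniform decay on horizontal segments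
  obtain ⟨K, T₁, hK, hM⟩ := exists_norm_le_exp_neg_abs_im hG hfin hP ha hb hfe hc hc1.le hc'α hc'h
    hc'N hPc'
  have hdecay : ∀ ε : ℝ, 0 < ε → ∃ T₀ : ℝ, ∀ T' : ℝ, T₀ ≤ |T'| → ∀ σ ∈ Icc c' c,
      ‖(fun w : ℂ ↦ G (2 * w) / P.eval (2 * w) * Complex.Gamma w * (π : ℂ) ^ (-w) *
        (x : ℂ) ^ (-w)) ((σ : ℂ) + T' * I)‖ ≤ ε := by
    intro ε hε
    set X₀ : ℝ := x ^ (-c) + x ^ (-c') with hX₀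
    have hX₀0 : 0 < X₀ := by positivity
    have hxpow : ∀ σ ∈ Icc c' c, x ^ (-σ) ≤ X₀ := by
      intro σ hσ
      have h1 : 0 < x ^ (-c) := Real.rpow_pos_of_pos hx _
      have h2 : 0 < x ^ (-c') := Real.rpow_pos_of_pos hx _
      rcases le_or_gt 1 x with h | h
      · have := Real.rpow_le_rpow_of_exponent_le h (neg_le_neg hσ.1)
        rw [hX₀]; linarith
      · have := Real.rpow_le_rpow_of_exponent_ge hx h.le (neg_le_neg hσ.2)
        rw [hX₀]; linarith
    refine ⟨max T₁ (K * X₀ / ε), fun T' hT' σ hσ ↦ ?_⟩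
    have hT₁ : T₁ ≤ |T'| := (le_max_left _ _).trans hT'
    have hT2 : K * X₀ / ε ≤ |T'| := (le_max_right _ _).trans hT'
    have hTpos : 0 < |T'| := lt_of_lt_of_le (by positivity) hT2
    have hw := hM ((σ : ℂ) + T' * I) (by simp; exact hσ.1) (by simp; exact hσ.2) (by simpa using hT₁)
    simp only [add_im, ofReal_im, mul_im, ofReal_re, I_im, mul_one, I_re, mul_zero, add_zero,
      zero_add] at hw
    simp only
    rw [norm_mul, Complex.norm_cpow_eq_rpow_re_of_pos hx]
    have hre : (-((σ : ℂ) + T' * I)).re = -σ := by simp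
    rw [hre]
    calc ‖G (2 * ((σ : ℂ) + T' * I)) / P.eval (2 * ((σ : ℂ) + T' * I)) *
          Complex.Gamma ((σ : ℂ) + T' * I) * (π : ℂ) ^ (-((σ : ℂ) + T' * I))‖ * x ^ (-σ)
        ≤ K * Real.exp (-|T'|) * X₀ :=
          mul_le_mul hw (hxpow σ hσ) (Real.rpow_nonneg hx.le _) (by positivity)
      _ ≤ K * |T'|⁻¹ * X₀ := by gcongr; exact exp_neg_le_inv hTpos
      _ = K * X₀ / |T'| := by ring
      _ ≤ ε := by rw [div_le_iff₀ hTpos]; rw [div_le_iff₀ hε] at hT2; nlinarith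
  -- the shift
  have hshift := integral_vertical_sub_eq_rectBoundaryIntegral hcc' hT hdiff hintc' hintc hdecay
  have hR := integral_right_line_eq_tsum ha hc hPc hx
  have hL := integral_left_line_eq_tsum hb hfe hc'α hc'h hc'N hPc' hx
  rw [← hR, ← hL, ← hshift]
  have hI : (1 : ℂ) / (2 * π * I) = -I / (2 * π) := by
    field_simp
    rw [I_sq]; norm_num
  rw [hI]
  rw [show (-I / (2 * π) : ℂ) * (I * (∫ y : ℝ, G (2 * ((c : ℂ) + y * I)) /
      P.eval (2 * ((c : ℂ) + y * I)) * Complex.Gamma ((c : ℂ) + y * I) *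
        (π : ℂ) ^ (-((c : ℂ) + y * I)) * (x : ℂ) ^ (-((c : ℂ) + y * I))) -
      I * (∫ y : ℝ, G (2 * ((c' : ℂ) + y * I)) / P.eval (2 * ((c' : ℂ) + y * I)) *
        Complex.Gamma ((c' : ℂ) + y * I) * (π : ℂ) ^ (-((c' : ℂ) + y * I)) *
          (x : ℂ) ^ (-((c' : ℂ) + y * I)))) =
      (-(I * I) / (2 * π)) * ((∫ y : ℝ, G (2 * ((c : ℂ) + y * I)) /
      P.eval (2 * ((c : ℂ) + y * I)) * Complex.Gamma ((c : ℂ) + y * I) *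
        (π : ℂ) ^ (-((c : ℂ) + y * I)) * (x : ℂ) ^ (-((c : ℂ) + y * I))) -
      (∫ y : ℝ, G (2 * ((c' : ℂ) + y * I)) / P.eval (2 * ((c' : ℂ) + y * I)) *
        Complex.Gamma ((c' : ℂ) + y * I) * (π : ℂ) ^ (-((c' : ℂ) + y * I)) *
          (x : ℂ) ^ (-((c' : ℂ) + y * I)))) by ring, I_mul_I]
  ring

end Hamburger1921

end Literature.Barriers.RiemannHypothesis
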